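import Literature.NumberTheory.Transcendental.GeometricHitRigidity
import Mathlib.Combinatorics.Additive.Corner.Roth
import HarnessLib

/-!
# Zero density of cusp hits along a geometric progression (Roth + rigidity)

Continuation of `GeometricHitRigidity.lean`. There: for integers `c ≥ 2`, `λ ≥ 1`, any linear jet
`αN + α₀` and a tail `g` analytic at `0` with `g 0 = 0` and NOT identically zero near `0`, along the
geometric progression `λcᵐ` only finitely many exponent-triples `{m, m+1, m+2}` are simultaneously hits
(`αN + α₀ + g(1/N) ∈ ℤ`). Here we upgrade this to the DENSITY statement that zero-log-density
("Theorem S"-type) counting problems ask for: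

* `geomHitExp_eventually_no_threeAP`: for every `p ≥ 1`, eventually in `m` the exponents
  `m, m + p, m + 2p` are not all hits (apply the rigidity theorem to ratio `cᵖ` and the `p` cosets
  `λcˢ·(cᵖ)ᵐ'`);
* `geomHitExp_density_zero`: the exponent hit set `E = {m : λcᵐ hit}` has upper density `0`:
  `∀ δ > 0, ∀ᶠ X, #(E ∩ [0, X)) ≤ δ·X`. Proof: by Roth's theorem (`roth_3ap_theorem_nat`, Mathlib) a
  subset of a window of length `n` of density `≥ δ/2` contains a non-trivial 3-term arithmetic
  progression, whose common difference is `≤ n`; beyond the (finitely many) thresholds of the first item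
  for `p ≤ n` no such progression exists in `E`, so every late window of length `n` carries `< (δ/2)n`
  exponents of `E`, and summing over windows gives `≤ δX`.

Consequence for the hits themselves: `#{N ≤ Y : N = λcᵐ a hit} = o(log Y)` — the zero-log-density
conclusion holds (even eventually, not only along a subsequence) for the part of ANY non-zero tail's hit
set that lies on a geometric progression, with a linear jet. Folklore in spirit (Roth 1953 + the Lucas
second-difference trick); we did not find it in print.
-/

namespace Literature.NumberTheory.Transcendental

open Filter Finset
open _root_.Topology

noncomputable section

open Classical in
/-- The EXPONENT hit set along `λ·cᵐ`: `m` with `α·λcᵐ + α₀ + g(1/(λcᵐ)) ∈ ℤ`. [folklore] -/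
def geomHitExp (c lam : ℕ) (α α₀ : ℂ) (g : ℂ → ℂ) : Set ℕ :=
  {m : ℕ | ∃ L : ℤ, α * ((lam * c ^ m : ℕ) : ℂ) + α₀ + g (((lam * c ^ m : ℕ) : ℂ))⁻¹ = L}

/-- **No late 3-term progressions of exponents, for every common difference.** [folklore] -/
theorem geomHitExp_eventually_no_threeAP {c lam : ℕ} (hc : 2 ≤ c) (hlam : 1 ≤ lam) (α α₀ : ℂ)
    {g : ℂ → ℂ} (hg : AnalyticAt ℂ g 0) (hg0 : g 0 = 0) (hne : ¬ ∀ᶠ z in 𝓝 (0 : ℂ), g z = 0)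
    {p : ℕ} (hp : 1 ≤ p) :
    ∀ᶠ m : ℕ in atTop, ¬ (m ∈ geomHitExp c lam α α₀ g ∧ m + p ∈ geomHitExp c lam α α₀ g ∧
      m + 2 * p ∈ geomHitExp c lam α α₀ g) := by
  -- ratio `c^p ≥ 2`, cosets `lam * c^s`, `s < p`
  have hcp : 2 ≤ c ^ p := by
    calc 2 ≤ c := hc
      _ = c ^ 1 := (pow_one c).symm
      _ ≤ c ^ p := Nat.pow_le_pow_right (by omega) hp
  have hcoset : ∀ s : ℕ, ∀ᶠ m' : ℕ in atTop, ∃ r : ℕ, r ≤ 2 ∧ ∀ L : ℤ,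
      α * ((lam * c ^ s * (c ^ p) ^ (m' + r) : ℕ) : ℂ) + α₀ +
        g (((lam * c ^ s * (c ^ p) ^ (m' + r) : ℕ) : ℂ))⁻¹ ≠ L := fun s => by
    have hlam' : 1 ≤ lam * c ^ s := Nat.mul_pos (by omega) (pow_pos (by omega) s)
    exact geometric_triple_hits_eventually_fail hcp hlam' α α₀ hg hg0 hne
  have hall : ∀ᶠ m' : ℕ in atTop, ∀ s ∈ Finset.range p, ∃ r : ℕ, r ≤ 2 ∧ ∀ L : ℤ,
      α * ((lam * c ^ s * (c ^ p) ^ (m' + r) : ℕ) : ℂ) + α₀ +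
        g (((lam * c ^ s * (c ^ p) ^ (m' + r) : ℕ) : ℂ))⁻¹ ≠ L :=
    (Finset.eventually_all (Finset.range p)).mpr fun s _ => hcoset s
  obtain ⟨M', hM'⟩ := eventually_atTop.mp hall
  refine eventually_atTop.mpr ⟨p * M', fun m hm => ?_⟩
  -- write `m = p * m' + s`
  set m' := m / p with hm'def
  set s := m % p with hsdef
  have hms : p * m' + s = m := Nat.div_add_mod m p
  have hs : s ∈ Finset.range p := Finset.mem_range.mpr (Nat.mod_lt _ (by omega))
  have hm' : M' ≤ m' := by
    rw [hm'def]
    exact (Nat.le_div_iff_mul_le (by omega)).mpr (by rw [mul_comm]; exact hm)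
  obtain ⟨r, hr, hfail⟩ := hM' m' hm' s hs
  -- the exponent `m + r * p` is the geometric point `lam * c^s * (c^p)^(m' + r)`
  have hexp : lam * c ^ s * (c ^ p) ^ (m' + r) = lam * c ^ (m + r * p) := by
    rw [← hms]; ring
  rintro ⟨h0, h1, h2⟩
  have hmem : m + r * p ∈ geomHitExp c lam α α₀ g := by
    obtain rfl | rfl | rfl : r = 0 ∨ r = 1 ∨ r = 2 := by omega
    · simpa using h0
    · simpa using h1
    · exact h2
  obtain ⟨L, hL⟩ := hmem
  rw [← hexp] at hL
  exact hfail L hL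

/-- A non-trivial 3-term arithmetic progression inside a set of naturals yields an increasing one:
`x, x + q, x + 2q ∈ A` with `q ≥ 1`. [folklore] -/
theorem exists_increasing_threeAP_of_not_threeAPFree {A : Set ℕ} (h : ¬ ThreeAPFree A) :
    ∃ x q : ℕ, 1 ≤ q ∧ x ∈ A ∧ x + q ∈ A ∧ x + 2 * q ∈ A := by
  simp only [ThreeAPFree, not_forall] at h
  obtain ⟨a, ha, b, hb, c, hc, habc, hab⟩ := h
  rcases Nat.lt_or_gt_of_ne hab with hlt | hgt
  · refine ⟨a, b - a, by omega, ha, ?_, ?_⟩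
    · have : a + (b - a) = b := by omega
      rw [this]; exact hb
    · have : a + 2 * (b - a) = c := by omega
      rw [this]; exact hc
  · refine ⟨c, b - c, by omega, hc, ?_, ?_⟩
    · have : c + (b - c) = b := by omega
      rw [this]; exact hb
    · have : c + 2 * (b - c) = a := by omega
      rw [this]; exact ha

open Classical in
/-- **Late windows are sparse** (Roth): with `ε > 0` and `n ≥ cornersTheoremBound (ε/3)`, `n ≥ 1`, if
beyond `M` the set `E` has no 3-term progression of any common difference `p ≤ n`, then every window
`[a, a + n)` with `a ≥ M` meets `E` in `< ε·n` points. [folklore] -/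
theorem window_card_lt_of_no_threeAP {E : Set ℕ} {ε : ℝ} (hε : 0 < ε) {n M : ℕ}
    (hn : cornersTheoremBound (ε / 3) ≤ n)
    (hno : ∀ p : ℕ, 1 ≤ p → p ≤ n → ∀ m : ℕ, M ≤ m → ¬ (m ∈ E ∧ m + p ∈ E ∧ m + 2 * p ∈ E))
    {a : ℕ} (ha : M ≤ a) :
    (((Finset.Ico a (a + n)).filter (fun m => m ∈ E)).card : ℝ) < ε * n := by
  by_contra hge'
  have hge := not_lt.mp hge'
  -- shift the window to `range n`
  set A : Finset ℕ := ((Finset.Ico a (a + n)).filter (fun m => m ∈ E)).image (fun m => m - a)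
    with hAdef
  have hAn : A ⊆ Finset.range n := by
    intro x hx
    rw [hAdef, Finset.mem_image] at hx
    obtain ⟨m, hm, rfl⟩ := hx
    rw [Finset.mem_filter, Finset.mem_Ico] at hm
    exact Finset.mem_range.mpr (by omega)
  have hinj : Set.InjOn (fun m => m - a) ((Finset.Ico a (a + n)).filter (fun m => m ∈ E) : Set ℕ) := by
    intro x hx y hy hxy
    simp only [Finset.coe_filter, Finset.mem_Ico, Set.mem_setOf_eq] at hx hy
    have : x - a = y - a := hxy
    omega
  have hcard : A.card = ((Finset.Ico a (a + n)).filter (fun m => m ∈ E)).card :=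
    Finset.card_image_of_injOn hinj
  have hAε : ε * n ≤ A.card := by rw [hcard]; exact hge
  have hroth := roth_3ap_theorem_nat ε hε hn A hAn hAε
  obtain ⟨x, q, hq, hx, hxq, hx2q⟩ := exists_increasing_threeAP_of_not_threeAPFree hroth
  -- pull back to `E`
  have hback : ∀ y : ℕ, y ∈ (A : Set ℕ) → a + y ∈ E ∧ y < n := by
    intro y hy
    rw [Finset.mem_coe, hAdef, Finset.mem_image] at hy
    obtain ⟨m, hm, rfl⟩ := hy
    rw [Finset.mem_filter, Finset.mem_Ico] at hm
    refine ⟨?_, by omega⟩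
    have : a + (m - a) = m := by omega
    rw [this]; exact hm.2
  obtain ⟨h0, -⟩ := hback x hx
  obtain ⟨h1, -⟩ := hback (x + q) hxq
  obtain ⟨h2, hlt2⟩ := hback (x + 2 * q) hx2q
  have hqn : q ≤ n := by omega
  refine hno q hq hqn (a + x) (by omega) ⟨h0, ?_, ?_⟩
  · have : a + x + q = a + (x + q) := by ring
    rw [this]; exact h1
  · have : a + x + 2 * q = a + (x + 2 * q) := by ring
    rw [this]; exact h2

open Classical in
/-- **Counting over windows**: if every window `[a, a + n)` with `a ≥ M` (`n ≥ 1`) meets `E` in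
`< ε·n` points, then `#(E ∩ [0, X)) ≤ M + n + ε·(X + n)` for all `X`. [folklore] -/
theorem card_filter_range_le_of_windows {E : Set ℕ} {ε : ℝ} (hε : 0 ≤ ε) {n M : ℕ} (hn : 1 ≤ n)
    (hwin : ∀ a : ℕ, M ≤ a → (((Finset.Ico a (a + n)).filter (fun m => m ∈ E)).card : ℝ) < ε * n)
    (X : ℕ) :
    (((Finset.range X).filter (fun m => m ∈ E)).card : ℝ) ≤ M + n + ε * (X + n) := by
  -- number of windows needed to cover `[M, X)`
  set K : ℕ := X / n + 1 with hKdef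
  have hcover : (Finset.range X).filter (fun m => m ∈ E) ⊆
      Finset.range M ∪ (Finset.range K).biUnion
        (fun k => (Finset.Ico (M + k * n) (M + k * n + n)).filter (fun m => m ∈ E)) := by
    intro m hm
    rw [Finset.mem_filter, Finset.mem_range] at hm
    rw [Finset.mem_union, Finset.mem_range, Finset.mem_biUnion]
    by_cases hmM : m < M
    · exact Or.inl hmM
    · right
      refine ⟨(m - M) / n, ?_, ?_⟩
      · rw [Finset.mem_range, hKdef]
        have h1 : (m - M) / n ≤ X / n := Nat.div_le_div_right (by omega)
        omega
      · rw [Finset.mem_filter, Finset.mem_Ico]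
        refine ⟨⟨?_, ?_⟩, hm.2⟩
        · have := Nat.div_mul_le_self (m - M) n
          omega
        · have := Nat.lt_div_mul_add (a := m - M) (by omega : 0 < n)
          -- m - M < (m - M)/n * n + n
          omega
  have h1 : (((Finset.range X).filter (fun m => m ∈ E)).card : ℝ) ≤
      ((Finset.range M).card : ℝ) + (((Finset.range K).biUnion
        (fun k => (Finset.Ico (M + k * n) (M + k * n + n)).filter (fun m => m ∈ E))).card : ℝ) := by
    have := (Finset.card_le_card hcover).trans (Finset.card_union_le _ _)
    exact_mod_cast this
  have h2 : (((Finset.range K).biUnion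
        (fun k => (Finset.Ico (M + k * n) (M + k * n + n)).filter (fun m => m ∈ E))).card : ℝ) ≤
      ∑ k ∈ Finset.range K, (((Finset.Ico (M + k * n) (M + k * n + n)).filter (fun m => m ∈ E)).card : ℝ) := by
    have := Finset.card_biUnion_le (s := Finset.range K)
      (t := fun k => (Finset.Ico (M + k * n) (M + k * n + n)).filter (fun m => m ∈ E))
    exact_mod_cast this
  have h3 : ∑ k ∈ Finset.range K,
      (((Finset.Ico (M + k * n) (M + k * n + n)).filter (fun m => m ∈ E)).card : ℝ) ≤
      ∑ _k ∈ Finset.range K, ε * n :=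
    Finset.sum_le_sum fun k _ => (hwin (M + k * n) (by omega)).le
  rw [Finset.sum_const, Finset.card_range, nsmul_eq_mul] at h3
  have hK : (K : ℝ) * (ε * n) ≤ ε * (X + n) := by
    have hKle : (K : ℝ) * n ≤ X + n := by
      have : K * n ≤ X + n := by
        rw [hKdef, Nat.add_mul, one_mul]
        have := Nat.div_mul_le_self X n
        omega
      exact_mod_cast this
    nlinarith
  have hM : ((Finset.range M).card : ℝ) = M := by rw [Finset.card_range]
  have hn0 : (0 : ℝ) ≤ n := by positivity
  linarith

open Classical in
/-- **Upper density zero of the exponent hit set along a geometric progression.** Let `c ≥ 2`,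
`λ ≥ 1`, `α, α₀ ∈ ℂ` (any linear jet), `g` analytic at `0` with `g 0 = 0` and not identically zero
near `0`. Then `E = {m : α·λcᵐ + α₀ + g(1/(λcᵐ)) ∈ ℤ}` has upper density `0`: for every `δ > 0`,
eventually `#(E ∩ [0, X)) ≤ δ·X`. Hence the hits of a non-zero tail lying on `λ·c^ℕ` number
`o(log Y)` below `Y` — the zero-log-density conclusion holds on geometric progressions. (Roth's
theorem + `GeometricHitRigidity`.) [folklore] -/
theorem geomHitExp_density_zero {c lam : ℕ} (hc : 2 ≤ c) (hlam : 1 ≤ lam) (α α₀ : ℂ)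
    {g : ℂ → ℂ} (hg : AnalyticAt ℂ g 0) (hg0 : g 0 = 0) (hne : ¬ ∀ᶠ z in 𝓝 (0 : ℂ), g z = 0)
    (δ : ℝ) (hδ : 0 < δ) :
    ∀ᶠ X : ℕ in atTop,
      (((Finset.range X).filter (fun m => m ∈ geomHitExp c lam α α₀ g)).card : ℝ) ≤ δ * X := by
  set E := geomHitExp c lam α α₀ g with hE
  set ε : ℝ := δ / 2 with hεdef
  have hε : 0 < ε := by positivity
  set n : ℕ := max (cornersTheoremBound (ε / 3)) 1 with hndef
  have hn1 : 1 ≤ n := le_max_right _ _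
  have hnb : cornersTheoremBound (ε / 3) ≤ n := le_max_left _ _
  -- thresholds for every common difference `p ≤ n`
  have hall : ∀ᶠ m : ℕ in atTop, ∀ p ∈ Finset.Icc 1 n,
      ¬ (m ∈ E ∧ m + p ∈ E ∧ m + 2 * p ∈ E) :=
    (Finset.eventually_all (Finset.Icc 1 n)).mpr fun p hp =>
      geomHitExp_eventually_no_threeAP hc hlam α α₀ hg hg0 hne (Finset.mem_Icc.mp hp).1
  obtain ⟨M, hM⟩ := eventually_atTop.mp hall
  have hno : ∀ p : ℕ, 1 ≤ p → p ≤ n → ∀ m : ℕ, M ≤ m → ¬ (m ∈ E ∧ m + p ∈ E ∧ m + 2 * p ∈ E) :=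
    fun p hp1 hpn m hm => hM m hm p (Finset.mem_Icc.mpr ⟨hp1, hpn⟩)
  have hwin : ∀ a : ℕ, M ≤ a →
      (((Finset.Ico a (a + n)).filter (fun m => m ∈ E)).card : ℝ) < ε * n :=
    fun a ha => window_card_lt_of_no_threeAP hε hnb hno ha
  have hbound := card_filter_range_le_of_windows hε.le hn1 hwin
  -- `M + n + ε (X + n) ≤ δ X` for large `X`
  have hn0 : (0 : ℝ) < n := by exact_mod_cast hn1
  obtain ⟨X₀, hX₀⟩ := exists_nat_gt ((M + n + ε * n) / ε)
  refine eventually_atTop.mpr ⟨X₀, fun X hX => (hbound X).trans ?_⟩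
  have hX' : ((M : ℝ) + n + ε * n) / ε < X := lt_of_lt_of_le hX₀ (by exact_mod_cast hX)
  rw [div_lt_iff₀ hε] at hX'
  rw [hεdef] at hX' ⊢
  nlinarith

end

end Literature.NumberTheory.Transcendental
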